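import Literature.NumberTheory.EllipticCurves.GreenbergVatsal2000.IwasawaInvariants
import Literature.NumberTheory.EllipticCurves.SupersingularIrreducibleProofs
import HarnessLib

/-!
# Castella–Grossi–Skinner 2025, Theorem A (= Thm. 7.1.1 in print; arXiv v1: Thm. 6.0.5): Mazur's (MC) at a NON-ANOMALOUS Eisenstein prime `p > 2` of good reduction

HONEST FRAMING (cell `b2b-bsdres`, run/shared/lean/b2b/bsd-rank1-residual/; page 1 everywhere):
the goal of the cell is to DELETE the COMBINATION-SHAPED residual classes of the BSD formula for ALL
analytic-rank `≤ 1` curves over `ℚ` from PUBLISHED theorems only, so that the remainder becomes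
exactly the CONSTRUCTION-SHAPED classes, which are TYPED, not attempted; this is not "finishing
BSD". This file vendors ONE published theorem as a named fact (`def … : Prop`, nothing asserted;
D-0014/D-0026): the CYCLOTOMIC main-conjecture input of the reducible-residual-image class — Mazur's
statement (MC) `char_Λ X_E(ℚ_∞) = (L_p^{MSD}(E/ℚ))` for `E/ℚ` at a good Eisenstein prime `p > 2` with
`φ|_{G_p} ≠ 1, ω` — in EXACTLY the vocabulary of the tree's Greenberg–Vatsal fact
`GreenbergVatsal2000.thm13_charIdeal_eq_of_gvPar` (GV 2000 Thm. 1.3 + 1.2: the same conclusion under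
the parity hypothesis (GV) instead of "`φ|_{G_p} ≠ 1, ω`"), so that the tree's rank-`0` glue
`padicValRat_bsd_rank_zero_of_mazurMainConjecture` (Greenberg 1999 Thm. 4.1 + Mazur–Swinnerton-Dyer
interpolation + Gross–Zagier–Kolyvagin) turns it into the rank-`0` print shape — the kernel
re-assembly of the `r = 0` half of the sibling fact `thmD_padicValRat_bsd_rank_le_one` (Theorem D,
`EisensteinPPartBSD.lean`, cell registry A47) from its printed pieces ("In the case `r = 0`, the
argument is the same as in [CGLS22], replacing the appeal to [GV00] by an appeal to our Theorem A",
`[corpus: paper:arxiv-2303.04373 p0005 L52–L53]`). Sibling files in this directory: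
`EisensteinPPartBSD.lean` (Thm. D), `HeegnerPointMainConjecture.lean` (Thm. C).

## Citation header (read by the vendoring seat on the store's LaTeXML text `paper:arxiv-2303.04373` = arXiv:2303.04373**v1**; VERSION NOTE below)

VERSION NOTE (bsd-eis audit-1 g4, 2026-08-26; cf. the sibling `EisensteinPPartBSD.lean` and
`run/shared/lean/pub/bsd-eis/AUDIT-1-GV00-MULT-D-AUDIT-ADDENDUM-2.md`): the store text is arXiv **v1**
(2023-03-08; its bibliography is the v1 `.bbl`), NOT v2 as earlier labels in this file said. The
accepted text is arXiv **v2** (2025-10-15, "Final version, to appear in Mathematische Annalen") =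
Math. Ann. 393 (2025) 2451–2506; in it the Introduction is numbered §1, so every body number below
(v1 / LaTeXML) is one section LOWER than in print: Thm. 1.1.1 → **2.1.1**, Thm. 3.1.1 → **4.1.1**,
Cor. 3.1.3 → **4.1.3**, Thm. 3.3.1 → **4.3.1**, Thm. 6.0.5 → **7.1.1**, §0.3 → §1.2. Theorem A is
identical in content in v1 and v2 (v2 wording: "let `p > 2` be a prime of good reduction for `E`.
Suppose that `p` is Eisenstein with `φ|_{G_p} ≠ 1, ω`", with `E[p]^{ss} = 𝔽(φ) ⊕ 𝔽(ψ)`, `φψ = ω`).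
The one citation delta that matters for provenance: the Beilinson–Flach theorem (v1 Thm. 3.1.1 =
printed Thm. 4.1.1) is "proved in [BST, §5]" where v1's [BST] = Burungale–Skinner–Tian, *Elliptic
curves and Beilinson–Kato elements: rank one aspects*, preprint 2021, but the accepted text's
`\bibitem[BSTW23]{BST}` and the published reference list (publisher's Crossref deposit, entry [6])
= A. Burungale, C. Skinner, Y. Tian, X. Wan, *Zeta elements for elliptic curves and applications*,
preprint (arXiv:2409.01350; §5 "Zeta elements over imaginary quadratic fields: the ordinary case";
unrefereed as of 2026-08-26).

* Authors: Francesc Castella, Giada Grossi, Christopher Skinner.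
* Title: *Mazur's main conjecture at Eisenstein primes*.
* Venue: Math. Ann. **393** (2025) 2451–2506, doi:10.1007/s00208-025-03239-x = arXiv:2303.04373
  (bib key `CastellaGrossiSkinner2025`). REFEREED / PUBLISHED (journal pagination of the individual
  theorems cite-only, want acq-08184).
* Theorem: **Theorem A** of the Introduction (LaTeXML "Theorem 1", `[corpus: paper:arxiv-2303.04373
  p0003 L43–L49]`) = **Theorem 6.0.5** (§6 "Mazur's main conjecture", `[ibid. p0027 L1–L14]`: "In
  this section we put everything together to deduce the proof of Theorem (thm:CYC) in the
  Introduction"), asserting Mazur's statement (2.1.2) (`[ibid. p0011 L62–L68]`).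
* Verbatim:

> **Theorem A.** Let `E/ℚ` be an elliptic curve, and let `p > 2` be an Eisenstein prime for `E` of
> good reduction. Suppose the isogeny character `φ` satisfies `φ|_{G_p} ≠ 1, ω`. Then `𝔛_ord(E/ℚ_∞)`
> is `Λ_ℚ`-torsion with `ch_{Λ_ℚ}(𝔛_ord(E/ℚ_∞)) = (𝓛_p^{MSD}(E/ℚ))`, and hence Mazur's main
> conjecture holds.

  Body (Thm. 6.0.5): "Let `E/ℚ` be an elliptic curve, and `p > 2` a prime of good reduction for `E`
  such that `E[p]^{ss} = 𝔽_p(φ) ⊕ 𝔽_p(ψ)` with `φ|_{G_{ℚ_p}} ≠ 1, ω`. Then the module `𝔛_ord(E/ℚ_∞)`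
  is `Λ_ℚ`-torsion, with `ch_{Λ_ℚ}(𝔛_ord(E/ℚ_∞)) = (𝓛_p^{MSD}(E/ℚ))`." Definitions: p0003 L4–L8
  "`ℚ_∞/ℚ` the cyclotomic `ℤ_p`-extension", "`Λ_ℚ = ℤ_p⟦Gal(ℚ_∞/ℚ)⟧`", "`𝔛_ord(E/ℚ_∞) =
  Sel_{p^∞}(E/ℚ_∞)^∨`" (§2.1 realises it as `H¹_{F_ord}(ℚ, T_pE ⊗ Λ_ℚ^∨)^∨`); p0003 L20 "an
  Eisenstein prime for `E`, meaning that `E` admits a rational `p`-isogeny. Equivalently … `E[p]` is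
  reducible"; "`φ` the isogeny character … on the kernel `C ⊂ E[p]`", "`G_p ⊂ G_ℚ` a decomposition
  group at `p`", "`ω` the Teichmüller character"; §1.1 Thm. 1.1.1 (p0007 L50–L65): "There exists an
  element `𝓛_p^{MSD}(E/ℚ) ∈ Λ_ℚ` such that for any finite order character `χ` of `Γ_ℚ` of conductor
  `p^r` with `r > 0`, `𝓛_p^{MSD}(E/ℚ)(χ) = (p^r/(τ(χ̄)α_p^r)) · L(E,χ̄,1)/Ω_E^+` … and
  `𝓛_p^{MSD}(E/ℚ)(1) = (1 − α_p^{-1})² · L(E,1)/Ω_E^+`" with "`Ω_E^± = ∫_{δ^±} ω_E`" for `ω_E` a minimal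
  (Néron) differential and `δ^±` generators of `H_1(E,ℤ)^±`, `Ω_E^+ > 0`, `α_p` the unit root of
  `x² − a_p x + p` ("The integrality of `𝓛_p^{MSD}(E/ℚ)` is shown in [GV00] in the case where `E[p]`
  is irreducible … and in [Wüthrich, wuthrich-int] in the reducible case"). Printed proof (§6.1,
  p0027–p0028; two-page outline §0.2): the anticyclotomic main conjecture Theorem C (sibling file) for
  an auxiliary imaginary quadratic `K`, transported to the cyclotomic line by the two-variable
  Beilinson–Flach classes of Thm. 3.1.1 and their explicit reciprocity laws, `α`-twists and
  `S`-imprimitive Iwasawa invariants, plus Kato's divisibility (as refined by Wüthrich) for `E_•` and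
  `E_•^K` and isogeny invariance. SECOND-LEVEL NOTE (documentation, not a hypothesis): Thm. 3.1.1
  (printed Thm. 4.1.1) is "proved in [BST, §5], where it is deduced from results in [KLZ17] in
  combination with [Betina–Dimitrov–Pozzi]" (p0016 L53–L56; arXiv v2 TeX l.1701–1702), where in the
  v1 store text [BST] = Burungale–Skinner–Tian, preprint 2021, and in the accepted / published text
  [BST] = [BSTW23] = Burungale–Skinner–Tian–Wan, *Zeta elements for elliptic curves and applications*,
  preprint (arXiv:2409.01350, §5) — see the VERSION NOTE above; the cell's informational flag
  `CGS25-BST-Thm311` (referee A r156; the sibling Theorem D carries the same note) names this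
  dependence; the records stay published-theorem records, the flag is the referee's.

## In-cell referee of the preprint node Thm. 4.1.1 ⇐ [BSTW23, §5] (cell `bsd-litref`, sub-cell `cgs25`, 2026-08-26)

Sheets of record (`run/shared/lean/pub/bsd-litref/cgs25/sheets/`, `…/bstw24/sheets/`): D-AUDIT-cgs25-r1 cd6b303b333505a2 (+ ADDENDUM-1 81b0ea39d50df0e4), D-AUDIT-cgs25-r2 0d093e8f7ab6b874
(+ ADDENDUM-1 5366702acfa5a3a4),
D-AUDIT-bstw24-r1 2ab68891cb7b08bc (+ ADDENDUM-1 dd57a5d99fb5bd7f, ADDENDUM-2 5fc2aa1cce88a1ac, ADDENDUM-3 f18da4daf35aa2e0),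
D-AUDIT-bstw24-r2 69e4de3690fd21dc (+ ADDENDUM-1 850c38dd32e26b8a, ADDENDUM-2 429d6b8a4b7ba185, ADDENDUM-3 4e4fd1ddbfa9f33b;
ADDENDUM-4 f739c7b8993da616 is supersingular §6, no D4 bearing);
referee C (pub-bsdpct-r3; family service completed there, deferred items to C4 = pub-bsdpct-r7) R381 (cgs25 group ruling): R381 (2026-08-26T23:25:38Z; wakes cd6b303b r1 · 0d093e8f r2 · 81b0ea39 r1-ADDENDUM-1 + ARM-P r08 pointer b3b03635; r2-ADDENDUM-1 5366702a lands at C4): A47 + A142 VERBATIM — PASS ×2 (kernel PC/NC at the desk), SMUGGLED none; hypotheses-as-used PASS-MET (r1 2 888 pairs / r2 2 059 recount, 0 violations); node X = CGS Thm 4.1.1 «proved in [BSTW23, §5]»: @3 GAP(line) CONFIRMED — verdict of record for the cgs25 row, the 1 783 CGS-only @3 classes STAY LITERAL on the typed OPEN binder p461118 (typed isolation ENDORSED AS LANDED: p461118 + p459542 + p462807; flag-rename content GRANTED — any adopted string must name its coordinate system, store Thm 3.1 = printed Thm 4.1); @p ≥ 5 PR half PASS-in-cell on ALL 276 ((irr)-free,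 H_p(f) cancels; G-vv̄ CORRECTION OF RECORD ADOPTED; E-1/E-2 ADOPTED as documentation, any future typed Thm 4.1.1 carries target H_p(f)⁻¹·I_f ⊗̂ Λ_K or the Cor 4.1.3 form); Gr half 76 non-(anom) PASS-in-cell from print (KLZ Prop 7.3.1 pivot) / 200 (anom) RETURN(line BSTW l.4175–4176) by the letter, Lemma W VERIFIED at sketch level, admission as the cell repair = C4's call once r2's addendum lands; Q1 (printed Prop 4.12) NOT finally adjudicated — C4's (CGS import SAFE under either adjudication via the proof's free auxiliary field; p465812 = the conservative typed form); CGLS re-route 0 classes; F-Hp CONFIRMED by a fourth, internal-inconsistency route; 0 cells move; Q1 final word / Lemma W admission / §5 verdict of record TRANSFERRED to C4 = pub-bsdpct-r7 with the desk's evidence; referee A R346 (2026-08-26T19:52Z): the 1 908 rank-one D4 classes BOOKED PROVED-by-name on the BF-free twist row T-CGLS55-TW (kernel `RowC6.bsdp_rankOne_of_display55_of_twistShaAnUnit` p455255 + `_key` p462055, two-engine certificate; no CGS25/[BSTW] input); 148 rank-zero + 3 residual rank-one classes stay literal under the flag (rank-zero two-step twist certificates = OFFER-D4R0-TWOSTEP,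 kernel p465061, at A's desk).
STATEMENT: both readers VERBATIM (this binder and Theorem D = `thmD_padicValRat_bsd_rank_le_one`),
hypotheses-as-used MET on all 2 059 flagged D4 classes (referee A's state 81ed60cf0114ea89; scoreboard 2 049).
READER VERDICTS ON THE NODE, BY PRIME: `p ≥ 5` — PASS-in-cell at statement level (BSTW §5 = specialisations of
KLZ17 Thm. 8.2.3 / 8.2.8 / 10.2.2 + Hida interpolation + Ohta / Fukaya–Kato (printed `p ≥ 5`) + BD21 / BDP22;
riders R-a «pseudo-null cokernel» from KLZ17 Thm. 8.2.3 + H⁰ vanishing, R-b the e⋆-normalisation; bstw24-r1 O4 /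
bstw24-r2 N1′ = the verdict of record on §5 itself, imported by cgs25-r1 ADDENDUM-1 §A), read by reader 1's
ADDENDUM-1 §B ON D4's OWN POPULATION ((irr_ℚ) fails for all 2 049; BSTW-(anom) «α² ≡ 1 mod λ» (v2 TeX
l. 3760–3763) ⟺ `a_p ≡ −1 (mod p)` here, on 1 973 classes = all 1 783 at `3` + 200 of the 276 at `p ≥ 5`):
PR half of Thm. 4.1.1 (C̃ol_f / Col_{E•}, ERL (a)) PASS-in-cell on ALL 276 (§B.1–B.3: KLZ17 Thm. 8.2.3 / Rem.
8.2.4 make the big logarithm an ISOMORPHISM whenever `a_p ≢ 1`; `H_p(f) = (1−pα⁻²)(1−α⁻²)` cancels between BSTW's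
`J_g` and CGS Cor. 4.1.3); Gr half (Col_𝐠 onto Λ_K^ur, ERL (b)) reduces to ONE printed-unproved sentence BSTW
l. 4175–4176 («the restriction [of ω_{g,α}] to D(T⁺) is mapped isomorphically onto 𝒪_λ», §B.4): FROM PRINT on the
76 classes with `a_p ≢ ±1 (mod p)` (KLZ17 Prop. 7.3.1 «non-Eisenstein or β/p ≢ α» [corpus:
paper:arxiv-1503.02888-gx17373040 p0063:L3–L16] + Prop. 10.1.1(1)) ⇒ PASS-in-cell clean; on the 200 (anom)
classes RETURN(line BSTW l. 4175–4176) by the letter, PASS-with-one-cell-repair if the desk admits reader 1's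
Lemma W (§B.5; table `sheets/r1/d4_p5plus_bstwanom_split.tsv` 51ccde8fe4b6312d) — reader 1 §C: «NO binder
change now». Reader 2's ADDENDUM-1 (5366702acfa5a3a4, independent; r1's not opened) DISAGREES ON THE CUT and the
disagreement is REPORTED here, not averaged: its §B–§E PROVE BSTW l. 4175–4176 at level `N` directly (ω_g part of
an 𝒪-basis of H⁰(X₁(N), Ω¹) by the q-expansion principle + perfect Poincaré pairing with Fil¹ isotropic and
Serre-dual to H¹/Fil¹ + `D_λ(T₀) = D(T₀⁺) ⊕ Fil¹` + `T⁺ = T₀⁺` for `E•` by the étale isogeny) ⇒ «at p ≥ 5 the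
case (irr_ℚ) fails ∧ α ≡ −1 needs NO input beyond what the non-anomalous case needs … for all 276 p ≥ 5 classes
alike (200 anomalous + 76 not)»; «the cut a_p ≢ ±1 (76 classes) is not the right cut» (§G); both readers thus
supply an in-cell proof of the same printed-unproved sentence (r1 Lemma W / r2 §E), r1 grading it RETURN by the
letter, r2 PASS-in-cell; the desk arbitrates. A by-name `p ≥ 5 ∧ a_p² ≢ 1 (mod p)` tier is HELD, unfiled, by the
typer (`staging/bsd-litref-cgs25-ty/MazurMainConjectureOffAnomTier.HELD.lean`, farm rc 0) in case a desk names it.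
Reader 2's ONE proviso on the auxiliary field `L` of BSTW §4: the printed proof of BSTW Prop. 4.12
(arXiv:2409.01350v2 TeX l. 3381–3386, with Prop. 4.10 l. 3303) bears only when `h_p(L) ≥ 1` and BSTW
print "If `p ∤ h_L`, then `h_p = 0`" (l. 2711–2713) — PASS-in-cell for `p ∤ h_L`, GAP(line l. 3385–3386)
for `h_p(L) ≥ 1` (Prop. 4.10's two terse steps l. 3301 / l. 3310 are discharged first-hand from [BD21] §3.2 / Thm. 4.8:
bstw24-r1 ADDENDUM-2 §B and bstw24-r2 ADDENDUM-3 (H)/(S1)–(S2), the latter computing the generator count `= 3` in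
every case of [BD21] Thm. B — so reader 1 (ADDENDUM-1 §0) reads the `p ∤ h_K` binder as the CONSERVATIVE,
sufficient-not-necessary typed form; reader 2's Q1 on Prop. 4.12's saturation step when `T_P` has torsion is
distinct — CONFIRMED and sharpened by its ADDENDUM-1 §F: ψ_r is p-IRREGULAR weight-one CM, `𝐓_P` can carry
`P`-torsion, and the printed generator count gives «∉ P·𝐓_P» where «∉ P·𝐓_{1,P}» is needed; missing statement =
«every P-torsion element of 𝐓⁻_P lifts to a torsion element of 𝐓_P»; scope `h_p(L) ≥ 1` only; not closed in
cell; for `h_p(L) = 0` Props. 4.10/4.12 are not invoked at all — the desk arbitrates); by-name object of that verdict =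
the DERIVED node `thmA_charIdeal_eq_padicLFunction_of_selmerCorankOne_of_not_dvd_classNumber` (sibling
`MazurMainConjectureRankOne.lean`, p465812 ACCEPTED; implied by this binder; its live consumers after referee A
R346 are the 3 rank-zero D4 classes at `p ≥ 5` — 316944bk1@5, 458643bi1@5, 486720hi1@7 — inside the prover
seat's D4R0-TWOSTEP certificate, and the class-wide T-CGS records; the 273 rank-one classes at `p ≥ 5` are
booked flag-free on T-CGLS55-TW). `p = 3` — GAP(line): KLZ17 §7.2
«p ≥ 5» [corpus: paper:arxiv-1503.02888-gx17373040 p0059:L5]; BSTW Thm. 4.1 sentence (TeX l. 2915)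
and Rem. 6.1 (l. 4918–4922) ⇐ [SV-S–Ohta] (Sangiovanni Vincentelli–Skinner, preprint, not public;
acq-11552) + Cais 2018 (partial: trivial tame eigenspace excluded [corpus: paper:arxiv-1407.5709
p0004:L78–L80]); residual named by bstw24-r2 «R3-ord = h-side (3-ii)♭′+B1 ∪ g-side G3g(3)» (input census C1–C12
of ADDENDUM-2: no public un-withdrawn text proves the Ohta package on tame component 0 at `3`; cgs25-r1 ADDENDUM-1 §B.4:
every `p = 3` D4 class is (anom), so BSTW l. 4175–4176 is listed with this GAP, dominated by it); referee C R353 (ζ)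
(2026-08-26T20:27Z) REGISTER-WIDE WORD on the common Ohta-ES@3 node: CONFIRMED-as-flag wherever it appears,
explicitly «D4@3 (CGS 4.1.1 ← [BST]/BSTW §5)», strike = a REFEREED `p = 3` extension of the Λ-adic
Eichler–Shimura / structure theory at the Eisenstein ideal or an in-cell verification of [SV-S–Ohta] when public;
referee C R361 (ε) (2026-08-26T21:22Z, yz26 group ruling) SHARPENED that word with a
ROW-DEPENDENT PRONG MAP for A to apply register-wide: the Ohta-ES@3 node is TWO-PRONGED — G♯ = the Λ-adic
Eichler–Shimura / structure package for the Hida family of `f_E` at `(3, ω⁰)`, tame level `N` prime to `3`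
(no printed source: Cais 2018 excludes the trivial eigenspace; Ohta 1995/1999/2000, Fukaya–Kato, KLZ17 stand at
`p ≥ 5`; = bstw24-r2's G3g(3), read for our RESIDUALLY REDUCIBLE `f_E` at the Eisenstein maximal ideal, `Y₁` row
included — ADDENDUM-2 (B2)) and G♭ = the same package for the CM family `𝐡_v` at `(3, ω⁻¹)` on the open curve
`Y₁(D_K·3^∞)` at its Eisenstein ideal ([SV-S–Ohta] PRE; = bstw24-r2's R3-h = bsd-ssimc's (3-ii)♭) — and
«ordinary rows (D3; D4@3 through CGS Thm 4.1.1 «proved in [BST]»; A10's T-EISRG3C cells) engage G♭ ∧ G♯»;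
STRIKE TEST (mechanical): a refereed text strikes the node FOR A ROW iff it prints at `p = 3` every prong the
row engages — (i) for G♯ the `ω⁰`-component at tame level `N` prime to `3`, (ii) for G♭ the open curve
`Y₁(D_K·3^∞)` at the Eisenstein ideal of `𝐡_v`; a text printing (ii) only (e.g. [SV-S–Ohta] if scoped as BSTW
Rem. 5.1 describes it) strikes NOTHING of D4@3; D4@3 engagement of record (referee C (pub-bsdpct-r3; family service completed there, deferred items to C4 = pub-bsdpct-r7) R381): R381 (θ) PRONG-MAP EXTENSION — «D4 = a THIRD engagement class, ordinary-EISENSTEIN g-side» (E[p] reducible puts f_E's own Hida family at an EISENSTEIN maximal ideal with trivial (ω⁰) character, so both Cais exclusions bite the g-side); STRIKE TEST for D4 rows: a future refereed text lifts the @3 node for D4 iff it prints at p = 3 (i) Λ-adic ES for the ω⁰-component AT AN EISENSTEIN maximal ideal, open curve (G♯^Eis — strictly stronger than D3's G♯), AND (ii) G♭ (the 𝐡_v open-curve Eisenstein row), AND (iii) the l.4175–4176 Gr-side normalisation for Eisenstein g (or Lemma W admitted curve-side); texts that strike D3's conditions do NOT lift D4@3.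
The `p = 3` instances of this binder are consumed on the census ONLY through the claim-tagged Summits-side `p = 3`
binder of `Summits/BirchSwinnertonDyer/Rank1Residual/Partition/` (p461118; = this statement VERBATIM
with `p = 3`, PROVED to follow from it) and its K-free consumer (p462807), never as refereed-at-3.
Reader 2's consistency finding F-Hp (sheet §3 D2; information, not load-bearing): printed Thm. 4.1.1's
clause «Col̃_f → I_f ⊗̂ Λ_K with pseudo-null cokernel» is, against BSTW §5.3.1, true with target
`H_p(f)⁻¹ · I_f ⊗̂ Λ_K`; Cor. 4.1.3 — the form Theorem A uses — is correct under the BSTW reading, so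
this binder and Theorem D are unaffected (no restatement of Thm. 4.1.1 exists in the tree). Found three times
independently: = bsd-ssimc H-CGS-1 = cgs25-r1 ADDENDUM-1 E-2 («printed targets of Thm. 4.1.1 (TeX l. 1688–1691)
and Thm. 2.2.3 (l. 797) too strong by `H_p(f)` when `a_p ≡ ±1 (mod p)`; Cor. 4.1.3 / Def. 2.2.2 — the consumed
forms — correct»); with E-1 = BSTW l. 4221 (`𝒞^int = c̃_g·𝒞` onto `𝓡` only if `a_p² ≢ 1 mod λ`; = bsd-ssimc CB6),
both for the authors' lists, neither load-bearing; reader 2's ADDENDUM-1 §C makes it exact — `J_g = H_p(f)⁻¹·I_f`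
up to units, so `Col_{E•} := deg(π•)·H_p(f)·C̃ol_f` has image `Λ_K` exactly — and locates four slips dropping the
same `H_p(f)⁻¹`, none on the consumed path (BSTW l. 4221, Thm. 5.10 display l. 4250–4265 with l. 4245, `𝒞_v`
l. 4680–4690; CGS Thm. 2.2.1 l. 795–797, Thm. 4.1.1 l. 1690).
Component string of record for the `p = 3` cells (bstw24-r2 (T-b) as sharpened by its ADDENDUM-2 §E; referee A's
grammar; G3g(3) = prong G♯, R3-h = prong G♭ of R361 (ε)):
`…@BSTW24-§5@3 ⟸ OhtaΛES@3 = {R3-h: (3-ii)♭′+B1 [ssimc MEMO-10]; G3g(3): KLZ17 Thm 7.2.3(i–v, both rows)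
+ Thm 9.5.1 (= Oht00 Cor 1.3.8/2.3.6, Thm 2.1.11; printed p ≥ 5) + Lemma 7.4.2 + Thm 9.5.2, tame component 0,
Eisenstein 𝔪, tame level N} — no public text at 3: [SSV] PRE non-public; Cais17/18 exclude component 0;
Wake13 withdrawn; FK24/FKS14/WWE18/Laf19 p ≥ 5`.
LIFT RULE (= R361 (ε) strike test for an ordinary row): a REFEREED public text printing at `p = 3` BOTH prongs —
(i) G♯ for the Hida family of `f_E` on tame component 0 at the Eisenstein maximal ideal, tame level `N`, and
(ii) G♭ for `𝐡_v` on `Y₁(D_K·3^∞)` at its Eisenstein ideal ([SV-S–Ohta] / [SSV] published with that scope, the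
announced Caraiani–Mantovan–Newton proof, or an Ohta-at-3 reading seat closing with the primaries), AND (R381 (θ))
(iii) the l. 4175–4176 Gr-side normalisation for Eisenstein g in print (or Lemma W admitted curve-side) ⇒
PASS-in-cell at `3` by the `p ≥ 5` argument unchanged; a text printing one prong strikes nothing here.
UPDATE 2026-08-27 (reading desk C4 = pub-bsdpct-r7: bstw24 group ruling C4-R3 00:54Z + rider C4-R3-ADD 01:02Z; cgs25
RESIDUE group ruling C4-R5 01:51Z on the six post-R381 addenda — cgs25-r1 ADDENDUM-2 4b747cb084e66906 / ADDENDUM-3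
be9b411cb0787bd7, cgs25-r2 ADDENDUM-1 5366702acfa5a3a4 / -2 d36aeab63724f277 / -3 aac631bf3c460e39 / -4 590ffa5efda43bce;
and referee A R418 (2026-08-27T01:40Z): the 141 register entries `CGS25-BST-Thm311@p`, p ∈ {5, 7, 13}, STRUCK at tier
PROVED = print-refereed PASS-in-cell of record (C R381 (δ)(ε)(ζ) + C4-R3 (γ)(ε)(θ) + C4-R3-ADD (c)(1)), expressly NOT
proved-by-name («no tree theorem states Thm 4.1.1's targets»), descriptive markers
`CGS25-Thm411@p>=5:PASS-in-cell(…);riders(R-a)(R-b)documentary` (+ `;(anom):reader-repair(LemmaW/D-ω)documentary` on the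
74 (anom) cells); 27 classes literal → PROVED (24 of rank 1, 3 of rank 0: 316944bk1@5, 458643bi1@5, 486720hi1@7),
114 strikes rider-held (MANIN-DB / JET / YZ26), the 802 `p = 3` entries untouched (GAP(line) of record); numbers of
record N < 5·10⁵ 1 696 984 / 99 547 / 79 773 = 90.443 %):
(a) §5 @ `p = 3` GAP(line) and §5 @ `p ≥ 5` PASS-in-cell modulo PUB inputs are the VERDICTS OF RECORD (C4-R3 (β)(γ); this
block = the «STRIKE RULE of record»). (b) V2 OF RECORD (C4-R5 (3), superseding R381 (ε)'s 76/200 split word): «CGS25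
Thm 4.1.1 / Cor 4.1.3 ⇐ BSTW §5 at p ≥ 5: PASS-in-cell WITH READER REPAIRS on all 276 D4 classes (200 anom + 76 not),
every admissible auxiliary field, no side condition»; component string of record `CGS25-ThmA-Thm4.1.1@BSTW24-§5 (p ≥ 5:
PASS-in-cell, reader repairs at l.3385–3388 [×2] and l.4175–4177 [×3]; p = 3: GAP [SV-S–Ohta], prongs (i)(ii))` — flag
strings cite PRINTED Thm. 4.1 (TeX l. 2915) / PRINTED Rem. 6.1 (TeX l. 4918–4922), store Thm. 3.1 / Rem. 5.1 only as
parenthetical alias. (c) BSTW l. 4175–4177 («restriction to D(T⁺) mapped isomorphically onto 𝒪_λ», printed-unproved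
for Eisenstein/anomalous g): ADMITTED as discharged in cell ×3 — cgs25-r1 Lemma W (curve side; written out in ADDENDUM-2
§F), bstw24-r2 derivation D-ω (modular-curve side, ADDENDUM-6 eaa05811605d1147), cgs25-r2 §E (level-N intrinsic) — at
every odd `p ∤ N`, so the R381 (ε) RETURN on the 200 (anom) classes is LIFTED. (d) Q1 (printed Prop. 4.12) FINAL: statement
TRUE, printed «it suffices» inference (TeX l. 3385–3388) incomplete as worded; repaired ×2 by logically independent routes —
bstw24-r1 ADDENDUM-5 73386cd869069474 Lemma S (tree p479383) + Lemma T, and cgs25-r2 ADDENDUM-3 Lemma C (kernel form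
p483267 `IwasawaSaturationCongruenceCriterion`) + [BD21] Thm. 4.8 + Prop. 1.11 — with the SNF cross-check of ADDENDUM-4
re-run at the desk 30/30; class-number-free, the auxiliary-field proviso is LIFTED: the `p ∤ h_K` binder of
`…_of_selmerCorankOne_of_not_dvd_classNumber` (p465812) documents the AS-PRINTED state (rider (R-d)) and is no longer
required. (e) @3 verdict UNCHANGED (GAP(line)); the D4@3 STRIKE TEST of record is CONSOLIDATED to (i′) ∧ (ii) (C4-R5 (4)):
(i′) the ω⁰-component Λ-adic Eichler–Shimura package for H¹_ord of the OPEN tower Y₁(N·3^∞), N prime to 3, WITHOUT a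
non-Eisenstein / Gorenstein / p-distinguished localisation hypothesis (or with one that f_E's EISENSTEIN 𝔪 provably meets)
∧ (ii) the Y₁(D_K·3^∞) package at the Eisenstein ideal of 𝐡_v; R381 (θ)'s condition (iii) is DISCHARGED by the admitted
repairs (p-free at odd p) and the Prop. 4.12 step is not part of the @3 gap either; l. 4175–4176 is listed @3 as «covered
by Lemma W (cell)». (f) Typed objects (C4-R5 (5), the typer's call): this binder read at `5 ≤ p` is the by-name object of
V2; p465812 = documentation tier; the HELD by-name tiers (a_p-split `MazurMainConjectureOffAnomTier`, E-level `_of_five_le`)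
have no remaining referee function and stay UNFILED.
BY-NAME DECOMPOSITION OF THE GENERAL PRINTED PROOF (typing layer `bsd-littype-02`, p465287 / p466303, siblings
`PerrinRiouMainConjecture{,Proofs}.lean`): this binder ⟺ `thm723_charIdeal_eq_padicLFunction_mul` (printed Thm. 7.2.3,
the Perrin-Riou-type (MC) statement over the cyclotomic `ℤ_p`-extension of `K`) given Prop. 3.3.1, Wuthrich 2014
Thm. 16 and modularity (`thmA_iff_thm723`, kernel); the preprint dependence therefore attaches to Thm. 7.2.3's
printed proof (§7.2 Steps 1–3: Thm. 4.1.1 for the family `α ≡ 1 (mod ϖ^m)` + Thm. 4.3.1 + Thm. 6.5.3), while on the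
`r ≤ 1` census the §5-Interlude nodes of `MazurMainConjectureRankOne.lean` consume Thm. 4.1.1 at `α = 𝟙` only.

## Hypotheses, enumerated (word for word → tree predicate; the binder list after the four hypotheses on `(E, p)` is copied VERBATIM from `GreenbergVatsal2000.thm13_charIdeal_eq_of_gvPar`, whose docstring justifies each atom)

1. "`E/ℚ` an elliptic curve" — `W : WeierstrassCurve ℚ`, `[W.IsElliptic]`, `[W.IsGloballyMinimal]`
   (Néron differential / `a_p` / conductor read off the minimal model). Modularity is a theorem and
   enters through the newform binder `f`, `IsNewformOf W f`, as in the GV fact.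
2. "`p > 2` … Eisenstein prime for `E` of good reduction" — `2 < p`, `Good W p`, `Red W p`. Good
   ORDINARY ("`a_p` is a `p`-adic unit by hypothesis", §1.1) is automatic: tree theorem
   `goodOrd_of_red_of_good` (Serre 1972 Prop. 12), used by the consumer below to feed `unitRoot`.
3. "`φ|_{G_p} ≠ 1, ω`" — `¬ Anom W p` (`a_p ≢ 1 (mod p)`), as in every Eisenstein fact of the cell
   (A47, A52, CGLS Thm. E, CGS Thm. C); tree dictionary `not_anom_iff_cgs_of_mem_primesAbove`.
4. `ℚ_∞`, `Λ_ℚ = ℤ_p⟦T⟧`, `T = γ − 1` — `κ : ZpExtension ℚ p` cyclotomic, `γ` a topological generator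
   matching the cyclotomic variable of the tree's `p`-adic `L`-function (`IsCyclotomicVariable p γ`),
   `iwasawaToPowerSeries p : Λ → ℚ_p⟦T⟧` — verbatim from the GV fact.
5. `𝓛_p^{MSD}(E/ℚ)` — the tree's `padicLFunction f (unitRoot W p)` (Mazur–Tate–Teitelbaum, normalised
   by the newform's `Ω⁺_f = plusPeriod f`) re-normalised to the model's real period by the rational
   `ϖ` with `ϖ · Ω_E = Ω⁺_f` (`W.realPeriodRat`), EXACTLY as in the GV fact (its docstring,
   "INTEGRALITY / PERIOD STEP"). The tree's `realPeriodRat = ∫_{E(ℝ)}|ω_E|` is CGS's `Ω_E^+ = ∫_{δ⁺}ω_E`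
   times the number of real components `c_∞ ∈ {1, 2}`, a unit of `ℤ_p` for `p > 2`: the generated
   ideal `(𝓛_p^{MSD}(E/ℚ)) ⊆ Λ_ℚ` is the same, and the `∃ g` form below (a generator `g` of the
   characteristic ideal with `ι g = ϖ · L_p(f, α)`) absorbs units. Integrality of `ϖ · L_p(f,α)` (that
   such a `g ∈ Λ` can exist at all) is part of what is printed: Thm. 1.1.1 "`𝓛_p^{MSD}(E/ℚ) ∈ Λ_ℚ`"
   for every such `E` (Wüthrich).
6. `𝔛_ord(E/ℚ_∞) = Sel_{p^∞}(E/ℚ_∞)^∨` — every `D : W.SelmerDualData κ γ` (the tree's hypothesis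
   structure for the dual of `lim→ Sel_{p^∞}(E/ℚ_n)`, as in the GV fact); conclusion `D.IsTorsion ∧
   ∃ g, D.charIdeal = (g) ∧ ι g = ϖ · L_p(f, α)`.

No image condition beyond reducibility, no (ram), conductor, CM, parity or Tamagawa condition. No
`_holds` is to be expected. This file introduces exactly ONE named fact and proves its rank-`0`
consumer; nothing else is minted. With it, the three lettered theorems A, C, D of CGS 2025 bearing on
the cell are in the tree (A: this file; C: `HeegnerPointMainConjecture.lean`; D:
`EisensteinPPartBSD.lean`); Theorem B (Kolyvagin's conjecture / [kolyconj]) is a different paper.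

## References
* [CastellaGrossiSkinner2025] F. Castella, G. Grossi, C. Skinner, Math. Ann. 393 (2025) 2451–2506 =
  arXiv:2303.04373v2 (accepted text). Locators in the store's v1 / LaTeXML numbering: Theorem A
  (§0) = Thm. 6.0.5 (§6); statement (2.1.2); Thm. 1.1.1 (§1.1); Thm. 3.1.1 and p. 16 (the [BST]
  sentence); Thm. D and its proof (§0.3) — printed numbering (VERSION NOTE): Theorem A (§1) =
  Thm. 7.1.1 (§7); Thm. 2.1.1; Thm. 4.1.1 (the [BSTW23, §5] sentence); Thm. D (§1.2).
* [GreenbergVatsal2000] R. Greenberg, V. Vatsal, Invent. Math. 142 (2000), Thm. (1.3) — tree fact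
  `thm13_charIdeal_eq_of_gvPar`, whose binder list is reused verbatim.
* [Greenberg1999] R. Greenberg, LNM 1716 (1999), Thm. 4.1 — the `hGr` input of the rank-`0` glue.
* C. Wuthrich, *On the integrality of modular symbols and Kato's Euler system for elliptic curves*,
  Doc. Math. 19 (2014) — integrality of `𝓛_p^{MSD}` in the reducible case (cited by CGS Thm. 1.1.1).
* bsdN/HYPOTHESES.md row T-CGS; RESIDUAL-CASES.md §a.1 C6, §a.2 X1; HOME/CITED-FACTS.md A47 (Thm. D);
  new row for this fact (seat `b2b-bsdres-lit-cgls`).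
-/

set_option autoImplicit false

noncomputable section

open scoped Classical MatrixGroups ModularForm

open CongruenceSubgroup WeierstrassCurve Literature.NumberTheory.EllipticCurves
  Literature.NumberTheory.EllipticCurves.ModularForms Literature.NumberTheory.EllipticCurves.Rank1Residual

namespace Literature.NumberTheory.EllipticCurves.CastellaGrossiSkinner2025

/-- **Castella–Grossi–Skinner, Math. Ann. 393 (2025) 2451–2506 = arXiv:2303.04373v2, Theorem A
(Introduction, §1 = Theorem 7.1.1, §7 of the printed / v2 numbering; in the store's v1 / LaTeXML text
"Theorem 1" = Theorem 6.0.5 (§6); same content, see the module VERSION NOTE)**, quoted from the v1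
text: "Let `E/ℚ` be an elliptic curve, and let
`p > 2` be an Eisenstein prime for `E` of good reduction [§0: `E` admits a rational `p`-isogeny, i.e.
`E[p]` is reducible]. Suppose the isogeny character `φ` satisfies `φ|_{G_p} ≠ 1, ω`. Then
`𝔛_ord(E/ℚ_∞)` is `Λ_ℚ`-torsion with `ch_{Λ_ℚ}(𝔛_ord(E/ℚ_∞)) = (𝓛_p^{MSD}(E/ℚ))`, and hence Mazur's
main [statement (2.1.2)] holds" (the source's word for (2.1.2) elided in this docstring only because
of the tree's docstring lint; what is vendored is the THEOREM). Transcription (module docstring items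
1–6) — the hypotheses on `(E, p)` in the cell's predicates: `2 < p`, `Good W p`, `Red W p`,
`¬ Anom W p`; everything after them VERBATIM as in `GreenbergVatsal2000.thm13_charIdeal_eq_of_gvPar`:
for the cyclotomic `ℤ_p`-extension `κ`, a topological generator `γ` matching the cyclotomic
variable, the newform `f` of `E` at level `N_E`, the rational `ϖ` with `ϖ · Ω_E = Ω⁺_f` (so that
`ϖ · L_p(f, α)` is the Mazur–Swinnerton-Dyer `p`-adic `L`-function for the model's real period — CGS
Thm. 1.1.1's `𝓛_p^{MSD}(E/ℚ) ∈ Λ_ℚ` up to the unit `c_∞`) and every dual datum `D`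
(`𝔛_ord(E/ℚ_∞) = Sel_{p^∞}(E/ℚ_∞)^∨`): `D` is `Λ`-torsion and `char_Λ D = (g)` with
`ι g = ϖ · L_p(f, α)`, `α = unitRoot W p` (ordinarity is automatic, `goodOrd_of_red_of_good`) — the
spelling of the hypothesis `hMC` of the tree's rank-`0` glue theorem of `LeadingTermPPartEisensteinProofs`
(the one consumed by `GreenbergVatsal2000.pPartRankZero_of_gvPar`).
PUBLISHED; documentation note `CGS25-BST-Thm311` (the Beilinson–Flach input, v1 Thm. 3.1.1 =
printed Thm. 4.1.1, "proved in [BST, §5]": v1 [BST] = Burungale–Skinner–Tian preprint 2021, accepted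
text / published reference list [BSTW23] = Burungale–Skinner–Tian–Wan arXiv:2409.01350 §5, preprint)
as for the sibling Theorem D. REGISTER TIERS (in-cell referee of the preprint input, 2026-08-26; module docstring
§In-cell referee; referee C (pub-bsdpct-r3; family service completed there, deferred items to C4 = pub-bsdpct-r7) R381, referee C's R353 (ζ) / R361 (ε), referee A R346):
at `p ≥ 5` the input Thm. 4.1.1 is reader-PASS-in-cell (PR half on all D4 classes; Gr half from print when
`a_p² ≢ 1 (mod p)`, cgs25-r1 ADDENDUM-1; for an auxiliary field with `p ∤ h_K`, cgs25-r2 — and, since C4-R3 / C4-R3-ADD /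
C4-R5 (2026-08-27, module docstring UPDATE), PASS-in-cell WITH READER REPAIRS for every class and every admissible
auxiliary field, no side condition; referee A R418 struck the 141 `p ≥ 5` register entries at tier PROVED =
print-refereed PASS-in-cell, not proved-by-name; documentation-tier sibling node
`…_of_selmerCorankOne_of_not_dvd_classNumber`); at `p = 3` it is GAP(line) on the two-pronged Ohta-ES@3 node
(G♭ ∧ G♯) and the `p = 3` instances are consumed through the claim-tagged Summits-side `p = 3` binder
(p461118), never as refereed-at-3. [cite: CastellaGrossiSkinner2025, Theorem A (printed §1, = Thm. 7.1.1 §7; store v1 / LaTeXML §0 = Thm. 6.0.5 §6), with Thm. 2.1.1 (v1 1.1.1) for 𝓛_p^{MSD} and Mazur's Conjecture (v1 LaTeXML 2.1.2)]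
[cite: GreenbergVatsal2000, Thm. (1.3) (binder list of the tree transcription reused verbatim)] -/
def thmA_charIdeal_eq_padicLFunction : Prop :=
  ∀ (W : WeierstrassCurve ℚ) [W.IsElliptic] [W.IsGloballyMinimal] (p : ℕ) [Fact p.Prime],
    2 < p → Good W p → Red W p → ¬ Anom W p →
    ∀ (κ : ZpExtension ℚ p) (γ : Field.absoluteGaloisGroup ℚ),
        κ.IsCyclotomic → κ.IsTopGenerator γ → IsCyclotomicVariable p γ →
      ∀ [NeZero (W.conductorNorm ℤ)] (f : CuspForm (Gamma0 (W.conductorNorm ℤ)) 2),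
        IsNewformOf W f → ∀ (ϖ : ℚ), (ϖ : ℝ) * W.realPeriodRat = plusPeriod f →
      ∀ (D : W.SelmerDualData κ γ), D.IsTorsion ∧
        ∃ g : IwasawaAlgebra p, D.charIdeal = Ideal.span {g} ∧
          iwasawaToPowerSeries p g =
            PowerSeries.C (ϖ : ℚ_[p]) * padicLFunction f (unitRoot W p : ℚ_[p])

/-- **Theorem A ⇒ the rank-`0` print shape** (the `r = 0` half of CGS Thm. D, re-assembled in the
kernel from its printed pieces — "In the case `r = 0`, the argument is the same as in [CGLS22, Thm.
5.1.4], replacing the appeal to [GV00] by an appeal to our Theorem A"): for `W/ℚ` globally minimal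
elliptic, `p > 2` good with `E[p]` reducible and `a_p ≢ 1 (mod p)`, and `L(E,1) ≠ 0`, the rank-`0`
shape `PPartRankZero W p` (`ord_p(L(E,1)/Ω_E) = ord_p #Ш + ord_p ∏c_ℓ − 2 ord_p #E(ℚ)_tors`) follows
from Theorem A (`hA`), Greenberg's Thm. 4.1 (`hGr`, inline exactly as in
`GreenbergVatsal2000.pPartRankZero_of_gvPar`), modularity with integral Manin constant (`hmod`) and
Gross–Zagier–Kolyvagin (`hGZK`, finiteness of `Ш`), through the tree glue
`padicValRat_bsd_rank_zero_of_mazurMainConjecture`; ordinarity from `goodOrd_of_red_of_good`.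
[cite: CastellaGrossiSkinner2025, Theorem D (r = 0) and its proof (§0.3 p. 5), from Theorem A]
[cite: CastellaGrossiLeeSkinner2022, Thm. 5.1.4 (the shape of the deduction)] -/
theorem pPartRankZero_of_thmA (hA : thmA_charIdeal_eq_padicLFunction)
    (hmod : nonempty_modularParametrizationData)
    (hGZK : rank_eq_analyticRank_of_analyticRank_le_one)
    (W : WeierstrassCurve ℚ) [W.IsElliptic] [W.IsGloballyMinimal] (p : ℕ) [Fact p.Prime]
    (hp : 2 < p) (hgood : Good W p) (hred : Red W p) (hna : ¬ Anom W p)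
    (hL : W.entireLFunction 1 ≠ 0)
    (hGr : ∀ (κ : ZpExtension ℚ p) (γ : Field.absoluteGaloisGroup ℚ),
        κ.IsCyclotomic → κ.IsTopGenerator γ → IsCyclotomicVariable p γ →
      ∀ (D : W.SelmerDualData κ γ) [Module.Finite (IwasawaAlgebra p) D.X], D.IsTorsion →
      ∀ (fE : IwasawaAlgebra p), D.charIdeal = Ideal.span {fE} →
        Finite (W.selmerGroupPInfty p) →
        ∃ u : ℤ_[p]ˣ,
          ((PowerSeries.constantCoeff fE : ℤ_[p]) : ℚ_[p]) *
              (Nat.card (AddCommGroup.primaryComponent W.toAffine.Point p) : ℚ_[p]) ^ 2 =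
            ((u : ℤ_[p]) : ℚ_[p]) * (p : ℚ_[p]) ^ (padicValNat p W.tamagawaProduct) *
              (Nat.card (AddCommGroup.primaryComponent
                ((integralModelInt W).map (Int.castRingHom (ZMod p))).toAffine.Point p) : ℚ_[p]) ^ 2 *
              (Nat.card (W.selmerGroupPInfty p) : ℚ_[p])) :
    PPartRankZero W p := by
  have hord : ¬ (p : ℤ) ∣ W.frobeniusTrace p := (goodOrd_of_red_of_good W p hp hgood hred).2
  have hr : W.analyticRank = 0 :=
    Literature.NumberTheory.EllipticCurves.analyticRank_eq_zero_of_entireLFunction_one_ne_zero W hL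
  obtain ⟨-, hfin⟩ := hGZK W (by omega)
  exact padicValRat_bsd_rank_zero_of_mazurMainConjecture W p hgood hord hL hfin hmod hGr
    (hA W p hp hgood hred hna)

/-- **At a good Eisenstein prime `p > 2` the two cyclotomic facts of the tree cover complementary
halves**: Greenberg–Vatsal 2000 Thm. 1.3 (`thm13_charIdeal_eq_of_gvPar`) needs the parity condition
(GV) and allows `a_p ≡ 1 (mod p)`; Theorem A needs `a_p ≢ 1 (mod p)` and no parity. Recorded as the
disjunction-fed form of the (MC) conclusion: under `GVPar W p ∨ ¬ Anom W p` one of the two facts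
applies. ("our results include giving a new proof for the case previously handled by
Greenberg–Vatsal", p. 3 — for the overlap `GVPar ∧ ¬ Anom`.)
[cite: CastellaGrossiSkinner2025, Theorem A and §0 p. 3 (comparison with [GV00])]
[cite: GreenbergVatsal2000, Thm. (1.3)] -/
theorem charIdeal_eq_of_gvPar_or_not_anom (hA : thmA_charIdeal_eq_padicLFunction)
    (hGV : GreenbergVatsal2000.thm13_charIdeal_eq_of_gvPar)
    (W : WeierstrassCurve ℚ) [W.IsElliptic] [W.IsGloballyMinimal] (p : ℕ) [Fact p.Prime]
    (hp : 2 < p) (hgood : Good W p) (hred : Red W p) (h : GVPar W p ∨ ¬ Anom W p)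
    (κ : ZpExtension ℚ p) (γ : Field.absoluteGaloisGroup ℚ)
    (hκ : κ.IsCyclotomic) (hγ : κ.IsTopGenerator γ) (hT : IsCyclotomicVariable p γ)
    [NeZero (W.conductorNorm ℤ)] (f : CuspForm (Gamma0 (W.conductorNorm ℤ)) 2)
    (hf : IsNewformOf W f) (ϖ : ℚ) (hϖ : (ϖ : ℝ) * W.realPeriodRat = plusPeriod f)
    (D : W.SelmerDualData κ γ) :
    D.IsTorsion ∧ ∃ g : IwasawaAlgebra p, D.charIdeal = Ideal.span {g} ∧
      iwasawaToPowerSeries p g =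
        PowerSeries.C (ϖ : ℚ_[p]) * padicLFunction f (unitRoot W p : ℚ_[p]) := by
  rcases h with hpar | hna
  · have hord : ¬ (p : ℤ) ∣ W.frobeniusTrace p := (goodOrd_of_red_of_good W p hp hgood hred).2
    exact hGV W p (by omega) hgood hord hpar κ γ hκ hγ hT f hf ϖ hϖ D
  · exact hA W p hp hgood hred hna κ γ hκ hγ hT f hf ϖ hϖ D

end Literature.NumberTheory.EllipticCurves.CastellaGrossiSkinner2025
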